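/-
Copyright (c) 2026. All rights reserved.
Released under Apache 2.0 license as described in the file LICENSE.
-/
import Literature.NumberTheory.GaloisRepresentations.ConjugationDescent
import Literature.NumberTheory.GaloisRepresentations.ContinuousCohomologyNineTerm
import Literature.NumberTheory.GaloisRepresentations.GaloisCohomologyInfResProofs
import Literature.NumberTheory.GaloisRepresentations.ProfiniteIntersectionCocycleExtension
import HarnessLib

/-!
# Hochschild–Serre in low degree, numerically

Let `G` be a profinite group, `N ⊴ G` a closed normal subgroup and `M` a discrete `G`-module. We
prove the numerical content of the Hochschild–Serre spectral sequence in degrees `≤ 2` in the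
degenerate situation of the local Euler–Poincaré computation (Harari, *Galois Cohomology and
Class Field Theory*, proof of Prop. 10.12; Milne, *ADT*, I Lemma 2.9; Serre, *Cohomologie
galoisienne*, I §2.6 (b) and II §5.5):

* the `G/N`-module `H¹(N, M)` (conjugation action, `hOneRep`), discrete because every class is
  fixed by an open subgroup;
* **(HS1)** `#H¹(G, M) = #H¹(G/N, M^N) · #H¹(N, M)^{G/N}` when `H²(G/N, M^N) = 0` (the five-term
  exact sequence `0 → H¹(G/N, M^N) → H¹(G, M) → H¹(N, M)^{G/N} → H²(G/N, M^N)`), and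
* **(HS2)** `#H²(G, M) = #H¹(G/N, H¹(N, M))` when `H²(N, M) = 0` and
  `H²(G/N, M^N) = H³(G/N, M^N) = 0`.

Both are obtained by dimension shifting through the `G`- and `N`-acyclic module `C = C(G, M)`
(`isSES_coind`, `isSES_coind_restrict`, `subsingleton_coind`, `subsingleton_coind_restrict`) and its
`N`-invariants `C^N ≅ C(G/N, M)` (`subsingleton_coind_invariants`): with `Q = C/M`, the sequence
`0 → M^N → C^N → Q^N →δ₀ H¹(N, M) → 0` is exact, `X = im(C^N → Q^N)` has
`Hⁱ(G/N, X) ≅ Hⁱ⁺¹(G/N, M^N)`, inflation `H¹(G/N, Q^N) → H¹(G, Q) ≅ H²(G, M)` is bijective, and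
`H¹(G/N, Q^N) ≅ H¹(G/N, H¹(N, M))`.

## Main results

* `hOneRep N ρ`: `H¹(N, M)` as a discrete `G ⧸ N`-module.
* `natCard_two_eq_natCard_one_hOneRep` (HS2), `natCard_one_eq_mul` (HS1).
-/

noncomputable section

open CategoryTheory ContinuousCohomology Function

universe u

namespace Literature.NumberTheory.GaloisRepresentations

open _root_.TopRep _root_.Topology _root_.Filter
open Literature.NumberTheory.EllipticCurves (subgroupConj subgroupConj_apply_coe)

variable {G : Type u} [Group G] [TopologicalSpace G] [IsTopologicalGroup G] [CompactSpace G] [T2Space G]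
  [TotallyDisconnectedSpace G]
variable (N : Subgroup G) [N.Normal] [hN : IsClosed (N : Set G)]
variable {M : Type u} [AddCommGroup M] [TopologicalSpace M] [DiscreteTopology M]
variable (ρ : ContinuousRep G ℤ M)

/-! ### `H¹(N, M)` as a discrete `G ⧸ N`-module -/

section HOne

/-- The carrier `H¹(N, M)` of the `G ⧸ N`-module `hOneRep`, a type synonym of the continuous
cohomology group of the restriction, carrying the discrete topology. [folklore] -/
def HOne : Type u := continuousCohomology 1 ((ρ.restrict (subgroupIncl N)).toTopRep)

/-- The group structure of `H¹(N, M)` on the synonym. [folklore] -/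
instance : AddCommGroup (HOne N ρ) := inferInstanceAs (AddCommGroup (continuousCohomology 1 ((ρ.restrict (subgroupIncl N)).toTopRep)))

/-- The discrete topology on `H¹(N, M)`. [folklore] -/
instance : TopologicalSpace (HOne N ρ) := ⊥

/-- `H¹(N, M)` is discrete. [folklore] -/
instance : DiscreteTopology (HOne N ρ) := ⟨rfl⟩

/-- The identification `H¹(N, M) = HOne N ρ`. [folklore] -/
def HOne.of : continuousCohomology 1 ((ρ.restrict (subgroupIncl N)).toTopRep) ≃+ HOne N ρ := AddEquiv.refl _

/-- The conjugation action of `g ∈ G` on `H¹(N, M)` as a linear map of the carrier. [folklore] -/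
def conjAction (g : G) : HOne N ρ →ₗ[ℤ] HOne N ρ :=
  ((conjMap ρ.toTopRep N g 1).hom.toLinearMap.toAddMonoidHom : HOne N ρ →+ HOne N ρ).toIntLinearMap

omit [CompactSpace G] [T2Space G] [TotallyDisconnectedSpace G] hN in
/-- Unfolding `conjAction`. [folklore] -/
@[simp] theorem conjAction_apply (g : G) (y : HOne N ρ) :
    conjAction N ρ g y = HOne.of N ρ (conjMap ρ.toTopRep N g 1 ((HOne.of N ρ).symm y)) := rfl

/-- **The conjugation representation of `G ⧸ N` on `H¹(N, M)`** (inner automorphisms act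
trivially, `conjMap_eq_self_of_mem_one`). [cite: SerreLocalFields1979, VII §5 Prop. 3] -/
def conjRepr : Representation ℤ (G ⧸ N) (HOne N ρ) :=
  QuotientGroup.lift N
    { toFun := fun g => conjAction N ρ g
      map_one' := LinearMap.ext fun y => conjMap_one_one ρ.toTopRep N y
      map_mul' := fun g h => LinearMap.ext fun y => (conjMap_conjMap ρ.toTopRep N h g 1 y).symm }
    fun _ hn => LinearMap.ext fun y => conjMap_eq_self_of_mem_one ρ.toTopRep N hn y

omit [CompactSpace G] [T2Space G] [TotallyDisconnectedSpace G] hN in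
/-- `conjRepr (mk g) y = conjMap g y`. [folklore] -/
@[simp] theorem conjRepr_mk_apply (g : G) (y : HOne N ρ) :
    conjRepr N ρ (QuotientGroup.mk g) y = HOne.of N ρ (conjMap ρ.toTopRep N g 1 ((HOne.of N ρ).symm y)) := rfl

omit [T2Space G] in
/-- **Every class of `H¹(N, M)` is fixed by an open subgroup of `G`**: for a continuous cocycle
`φ : N → M`, an open normal `U` fixing the (finitely many) values of `φ` and with
`φ(u⁻¹ x u) = φ(x)` (uniform local constancy on the compact `N`) acts trivially on `[φ]`.
[cite: SerreGaloisCohomology1997, I §2.6 (b)] -/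
theorem exists_isOpen_forall_conjMap_eq (y : continuousCohomology 1 (subgroupRep ρ.toTopRep N)) :
    ∃ U : Subgroup G, IsOpen (U : Set G) ∧ ∀ u ∈ U, conjMap ρ.toTopRep N u 1 y = y := by
  haveI : CompactSpace N := isCompact_iff_compactSpace.mp hN.isCompact
  obtain ⟨φ, rfl⟩ := oneCocycleClass_surjective _ y
  -- uniform local constancy of `(x, u) ↦ φ(u⁻¹ x u)`
  let Φ : N → G → M := fun x u => φ.1 ⟨u⁻¹ * x * u, by
    have := Subgroup.Normal.conj_mem inferInstance (x : G) x.2 u⁻¹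
    rwa [inv_inv] at this⟩
  have hΦ : Continuous (Function.uncurry Φ) := by
    refine φ.1.continuous.comp (Continuous.subtype_mk ?_ _)
    exact ((continuous_snd.inv).mul (continuous_subtype_val.comp continuous_fst)).mul continuous_snd
  obtain ⟨V, hV, hVΦ⟩ := exists_nhds_one_forall_eq' (X := N) (P := G) Φ hΦ
  -- the stabiliser of the values
  have hfin : (Set.range φ.1).Finite := (isCompact_range φ.1.continuous).finite_of_discrete
  have hstab : (⋂ m ∈ hfin.toFinset, {g : G | ρ g m = m}) ∈ 𝓝 (1 : G) :=
    (Filter.biInter_finset_mem _).2 fun m _ => ρ.setOf_apply_eq_mem_nhds_one m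
  obtain ⟨U, hU⟩ := ProfiniteGrp.exist_openNormalSubgroup_sub_open_nhds_of_one isOpen_interior
    (mem_interior_iff_mem_nhds.2 (inter_mem hV hstab))
  have hU' : (U : Set G) ⊆ V ∩ ⋂ m ∈ hfin.toFinset, {g : G | ρ g m = m} := hU.trans interior_subset
  refine ⟨U, U.isOpen, fun u hu => ?_⟩
  rw [conjMap_oneCocycleClass]
  refine congrArg _ (Subtype.ext (ContinuousMap.ext fun x => ?_))
  rw [conj_pullback_apply]
  have h1 : φ.1 (subgroupConj N u x) = φ.1 x := by
    have := hVΦ x u (hU' hu).1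
    simp only [Φ, inv_one, one_mul, mul_one, Subtype.coe_eta] at this
    convert this using 2
    exact Subtype.ext (subgroupConj_apply_coe N u x)
  rw [h1]
  have h2 : φ.1 x ∈ hfin.toFinset := by rw [Set.Finite.mem_toFinset]; exact ⟨x, rfl⟩
  exact Set.mem_iInter₂.1 (hU' hu).2 (φ.1 x) h2

/-- **`H¹(N, M)` as a discrete `G ⧸ N`-module** under conjugation.
[cite: SerreGaloisCohomology1997, I §2.6 (b)] [cite: SerreLocalFields1979, VII §5] -/
def hOneRep : ContinuousRep (G ⧸ N) ℤ (HOne N ρ) :=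
  ContinuousRep.ofStabilizerMemNhdsOne (conjRepr N ρ) fun y => by
    obtain ⟨U, hUo, hU⟩ := exists_isOpen_forall_conjMap_eq N ρ ((HOne.of N ρ).symm y)
    have h : (QuotientGroup.mk '' (U : Set G) : Set (G ⧸ N)) ∈ 𝓝 (1 : G ⧸ N) :=
      (QuotientGroup.isOpenMap_coe (U : Set G) hUo).mem_nhds ⟨1, U.one_mem, rfl⟩
    refine Filter.mem_of_superset h ?_
    rintro _ ⟨u, hu, rfl⟩
    change conjRepr N ρ (QuotientGroup.mk u) y = y
    rw [conjRepr_mk_apply, hU u hu]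
    rfl

omit [T2Space G] in
/-- Unfolding the action of `hOneRep` on classes of elements of `G`. [folklore] -/
@[simp] theorem hOneRep_mk_apply (g : G) (y : HOne N ρ) :
    hOneRep N ρ (QuotientGroup.mk g) y = HOne.of N ρ (conjMap ρ.toTopRep N g 1 ((HOne.of N ρ).symm y)) := rfl

omit [T2Space G] in
/-- The invariants of `hOneRep` are the `G`-invariant classes `H¹(N, M)^{G/N}`. [folklore] -/
theorem mem_invariants_hOneRep_iff (y : HOne N ρ) :
    y ∈ (hOneRep N ρ).toTopRep.ρ.invariants ↔
      ∀ g : G, conjMap ρ.toTopRep N g 1 ((HOne.of N ρ).symm y) = (HOne.of N ρ).symm y := by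
  constructor
  · intro h g
    exact h (QuotientGroup.mk g)
  · intro h q
    induction q using QuotientGroup.induction_on with
    | H g => exact h g

end HOne

/-! ### Inflation in degree one -/

section Inflation

/-- The inclusion `V^N ↪ V` as a morphism `res_{G → G/N} V^N ⟶ V` (for inflation). [folklore] -/
def invariantsIncl {V : Type u} [AddCommGroup V] [TopologicalSpace V] [DiscreteTopology V]
    (τ : ContinuousRep G ℤ V) :
    TopRep.res (ContinuousMonoidHom.quotientMk N : G →* G ⧸ N) (τ.quotientInvariants N).toTopRep ⟶ τ.toTopRep :=
  TopRep.ofHom ⟨⟨(τ.invariantsOf N).subtype, continuous_of_discreteTopology⟩, fun _ => rfl⟩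

omit [CompactSpace G] [T2Space G] [TotallyDisconnectedSpace G] hN in
/-- Unfolding `invariantsIncl`. [folklore] -/
@[simp] theorem invariantsIncl_hom_apply {V : Type u} [AddCommGroup V] [TopologicalSpace V] [DiscreteTopology V]
    (τ : ContinuousRep G ℤ V) (v : τ.invariantsOf N) : (invariantsIncl N τ).hom v = (v : V) := rfl

/-- **Inflation `H¹(G/N, V^N) → H¹(G, V)`.** [cite: SerreGaloisCohomology1997, I §2.6] -/
abbrev infOne {V : Type u} [AddCommGroup V] [TopologicalSpace V] [DiscreteTopology V] (τ : ContinuousRep G ℤ V) :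
    continuousCohomology 1 (τ.quotientInvariants N).toTopRep ⟶ continuousCohomology 1 τ.toTopRep :=
  ContinuousCohomology.map (ContinuousMonoidHom.quotientMk N) (invariantsIncl N τ) 1

omit [CompactSpace G] [T2Space G] [TotallyDisconnectedSpace G] hN in
/-- Inflation in degree one is injective. [cite: SerreGaloisCohomology1997, I §2.6 (b)] -/
theorem infOne_injective {V : Type u} [AddCommGroup V] [TopologicalSpace V] [DiscreteTopology V]
    (τ : ContinuousRep G ℤ V) : Injective (infOne N τ) :=
  ContinuousCohomology.inf_one_injective (S := N) (invariantsIncl N τ) Subtype.val_injective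
    fun m hm => ⟨⟨m, fun n => hm n n.2⟩, rfl⟩

omit [CompactSpace G] [T2Space G] [TotallyDisconnectedSpace G] hN in
/-- **Inflation–restriction**: `H¹(G/N, V^N) → H¹(G, V) → H¹(N, V)` is exact.
[cite: SerreGaloisCohomology1997, I §2.6 (b)] -/
theorem infOne_exact_resSubgroup {V : Type u} [AddCommGroup V] [TopologicalSpace V] [DiscreteTopology V]
    (τ : ContinuousRep G ℤ V) : Function.Exact (infOne N τ) (resSubgroup τ.toTopRep N 1) :=
  ContinuousCohomology.exact_inf_res_one (S := N) (invariantsIncl N τ) (subgroupSubtypeHom N)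
    (Y := subgroupRep τ.toTopRep N) (TopRep.ofHom ⟨ContinuousLinearMap.id ℤ τ.toTopRep, fun _ => rfl⟩)
    Subtype.val_injective Topology.IsInducing.subtypeVal (fun m hm => ⟨⟨m, fun n => hm n n.2⟩, rfl⟩) (fun h => h.2)
    (fun s hs => ⟨⟨s, hs⟩, rfl⟩) bijective_id fun m => τ.continuous_apply_left m

end Inflation

/-! ### The connecting map `M₃^N → H¹(N, M₁)` of a short exact sequence, as a `G ⧸ N`-map -/

section Shift

variable {M₁ : Type u} [AddCommGroup M₁] [TopologicalSpace M₁] [DiscreteTopology M₁]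
variable {M₂ : Type u} [AddCommGroup M₂] [TopologicalSpace M₂] [DiscreteTopology M₂]
variable {M₃ : Type u} [AddCommGroup M₃] [TopologicalSpace M₃] [DiscreteTopology M₃]
variable {ρ₁ : ContinuousRep G ℤ M₁} {ρ₂ : ContinuousRep G ℤ M₂} {ρ₃ : ContinuousRep G ℤ M₃}
variable {f : ρ₁.toTopRep ⟶ ρ₂.toTopRep} {g : ρ₂.toTopRep ⟶ ρ₃.toTopRep}

omit [N.Normal] [IsTopologicalGroup G] [CompactSpace G] [T2Space G] [TotallyDisconnectedSpace G] hN in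
/-- A short exact sequence of discrete `G`-modules restricts to one of `N`-modules. [folklore] -/
theorem IsSES.restrictN (h : IsSES f g) : IsSES (restrictHom N f) (restrictHom N g) :=
  ⟨by ext m; exact congr(($(h.comp_eq_zero)).hom m), h.injective, h.exact_mid, h.surjective⟩

/-- **The connecting map `δ_N : M₃^N → H¹(N, M₁)`** of `0 → M₁ → M₂ → M₃ → 0` restricted to `N`,
as a function on the `G ⧸ N`-module `M₃^N`. [cite: SerreGaloisCohomology1997, I §2.6] -/
def deltaN (h : IsSES f g) (v : ρ₃.invariantsOf N) : HOne N ρ₁ :=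
  HOne.of N ρ₁ ((h.restrictN (N := N)).δ₀ ⟨v.1, v.2⟩)

omit [N.Normal] [CompactSpace G] [T2Space G] [TotallyDisconnectedSpace G] hN in
/-- Unfolding `deltaN`. [folklore] -/
theorem deltaN_apply (h : IsSES f g) (v : ρ₃.invariantsOf N) :
    deltaN N h v = HOne.of N ρ₁ ((h.restrictN (N := N)).δ₀ ⟨v.1, v.2⟩) := rfl

omit [CompactSpace G] [T2Space G] [TotallyDisconnectedSpace G] hN in
/-- **`δ_N` is `G`-equivariant**: `δ_N(g v) = g · δ_N(v)` for the conjugation action on `H¹(N, M₁)`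
(the conjugate of the cocycle of a lift is the cocycle of the translated lift). [folklore] -/
theorem deltaN_smul (h : IsSES f g) (a : G) (v : ρ₃.invariantsOf N) :
    deltaN N h (ρ₃.quotientInvariants N (QuotientGroup.mk a) v) =
      HOne.of N ρ₁ (conjMap ρ₁.toTopRep N a 1 ((HOne.of N ρ₁).symm (deltaN N h v))) := by
  have hNs := h.restrictN (N := N)
  -- a lift `w` of `v` and the lift `a w` of `a v`
  have hvw : (restrictHom N g).hom (h.lift v.1) = v.1 := h.g_lift v.1
  have hgw : (restrictHom N g).hom (ρ₂ a (h.lift v.1)) = (ρ₃.quotientInvariants N (QuotientGroup.mk a) v).1 := by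
    change g.hom (ρ₂ a (h.lift v.1)) = ρ₃ a v.1
    rw [ContinuousRep.hom_comm_apply g a, h.g_lift]
  have hvw' : (restrictHom N g).hom (h.lift v.1) ∈ (ρ₃.restrict (subgroupIncl N)).toTopRep.ρ.invariants := by
    rw [hvw]; exact v.2
  have hgw' : (restrictHom N g).hom (ρ₂ a (h.lift v.1)) ∈ (ρ₃.restrict (subgroupIncl N)).toTopRep.ρ.invariants := by
    rw [hgw]; exact (ρ₃.quotientInvariants N (QuotientGroup.mk a) v).2
  have A : hNs.δ₀ ⟨(ρ₃.quotientInvariants N (QuotientGroup.mk a) v).1, (ρ₃.quotientInvariants N (QuotientGroup.mk a) v).2⟩ =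
      oneCocycleClass _ (hNs.δ₀Cocycle (ρ₂ a (h.lift v.1)) hgw') := hNs.δ₀_apply_eq _ _ hgw
  have B : hNs.δ₀ ⟨v.1, v.2⟩ = oneCocycleClass _ (hNs.δ₀Cocycle (h.lift v.1) hvw') := hNs.δ₀_apply_eq _ _ hvw
  have C : conjMap ρ₁.toTopRep N a 1 (oneCocycleClass (ρ₁.restrict (subgroupIncl N)).toTopRep (hNs.δ₀Cocycle (h.lift v.1) hvw')) =
      oneCocycleClass (ρ₁.restrict (subgroupIncl N)).toTopRep
        (contOneCocycles.pullback (subgroupConj N a) (conjRepHom ρ₁.toTopRep N a) (hNs.δ₀Cocycle (h.lift v.1) hvw')) :=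
    map_oneCocycleClass _ _ _ _
  have D : (contOneCocycles.pullback (subgroupConj N a) (conjRepHom ρ₁.toTopRep N a) (hNs.δ₀Cocycle (h.lift v.1) hvw') :
      contOneCocycles (ρ₁.restrict (subgroupIncl N)).toTopRep) = hNs.δ₀Cocycle (ρ₂ a (h.lift v.1)) hgw' := by
    refine Subtype.ext (ContinuousMap.ext fun x => hNs.injective ?_)
    rw [hNs.f_δ₀Cocycle_apply]
    change (restrictHom N f).hom (ρ₁ a ((hNs.δ₀Cocycle (h.lift v.1) hvw').1 (subgroupConj N a x))) = _
    rw [restrictHom_hom_apply, ContinuousRep.hom_comm_apply f a, ← restrictHom_hom_apply (N := N) f,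
      hNs.f_δ₀Cocycle_apply]
    change ρ₂ a (ρ₂ ((subgroupConj N a x : N) : G) (h.lift v.1) - h.lift v.1) = ρ₂ (x : G) (ρ₂ a (h.lift v.1)) - ρ₂ a (h.lift v.1)
    rw [map_sub, subgroupConj_apply_coe, ← Module.End.mul_apply, ← _root_.map_mul, ← Module.End.mul_apply,
      ← _root_.map_mul, mul_assoc, mul_inv_cancel_left]
  rw [deltaN_apply, deltaN_apply]
  change HOne.of N ρ₁ (hNs.δ₀ _) = HOne.of N ρ₁ (conjMap ρ₁.toTopRep N a 1 (hNs.δ₀ ⟨v.1, v.2⟩))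
  refine congrArg _ ?_
  exact A.trans ((congrArg _ D).symm.trans (C.symm.trans (congrArg (fun y => conjMap ρ₁.toTopRep N a 1 y) B.symm)))

/-- **`δ_N : M₃^N → H¹(N, M₁)` as a morphism of discrete `G ⧸ N`-modules.** [folklore] -/
def deltaNHom (h : IsSES f g) : (ρ₃.quotientInvariants N).toTopRep ⟶ (hOneRep N ρ₁).toTopRep :=
  TopRep.ofHom
    { toLinearMap :=
        ({ toFun := deltaN N h
           map_zero' := by
             rw [deltaN_apply]
             have e : (⟨(0 : ρ₃.invariantsOf N).1, (0 : ρ₃.invariantsOf N).2⟩ :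
                 (ρ₃.restrict (subgroupIncl N)).toTopRep.ρ.invariants) = 0 := rfl
             rw [e, map_zero, map_zero]
           map_add' := fun a b => by
             rw [deltaN_apply, deltaN_apply, deltaN_apply]
             have e : (⟨(a + b : ρ₃.invariantsOf N).1, (a + b : ρ₃.invariantsOf N).2⟩ :
                 (ρ₃.restrict (subgroupIncl N)).toTopRep.ρ.invariants) = ⟨a.1, a.2⟩ + ⟨b.1, b.2⟩ := rfl
             rw [e, map_add, map_add] } : ρ₃.invariantsOf N →+ HOne N ρ₁).toIntLinearMap
      cont := continuous_of_discreteTopology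
      isIntertwining' := by
        rintro ⟨a⟩
        ext v
        exact deltaN_smul N h a v }

omit [T2Space G] in
/-- Unfolding `deltaNHom`. [folklore] -/
theorem deltaNHom_hom_apply (h : IsSES f g) (v : ρ₃.invariantsOf N) : (deltaNHom N h).hom v = deltaN N h v := rfl

/-- The image `X = im(M₂^N → M₃^N)` as a `G ⧸ N`-stable submodule of `M₃^N`. [folklore] -/
def imSub (g : ρ₂.toTopRep ⟶ ρ₃.toTopRep) : Submodule ℤ (ρ₃.invariantsOf N) :=
  LinearMap.range (ContinuousRep.invariantsHom (N := N) g).hom.toLinearMap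

omit [CompactSpace G] [T2Space G] [TotallyDisconnectedSpace G] hN in
/-- `X` is `G ⧸ N`-stable. [folklore] -/
theorem imSub_le_comap (g : ρ₂.toTopRep ⟶ ρ₃.toTopRep) (q : G ⧸ N) :
    imSub N g ≤ (imSub N g).comap (ρ₃.quotientInvariants N q) := by
  induction q using QuotientGroup.induction_on with
  | H a =>
    rintro v ⟨w, rfl⟩
    refine ⟨ρ₂.quotientInvariants N (QuotientGroup.mk a) w, Subtype.ext ?_⟩
    exact ContinuousRep.hom_comm_apply g a w.1

/-- **`X` as a discrete `G ⧸ N`-module.** [folklore] -/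
def imRep (g : ρ₂.toTopRep ⟶ ρ₃.toTopRep) : ContinuousRep (G ⧸ N) ℤ (imSub N g) :=
  (ρ₃.quotientInvariants N).subrepresentation (imSub N g) (imSub_le_comap N g)

/-- The inclusion `X ↪ M₃^N`. [folklore] -/
def imIncl (g : ρ₂.toTopRep ⟶ ρ₃.toTopRep) : (imRep N g).toTopRep ⟶ (ρ₃.quotientInvariants N).toTopRep :=
  TopRep.ofHom
    { toLinearMap := (imSub N g).subtype
      cont := continuous_of_discreteTopology
      isIntertwining' := fun q => by ext v; rfl }

/-- The corestriction `M₂^N ↠ X`. [folklore] -/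
def toIm (g : ρ₂.toTopRep ⟶ ρ₃.toTopRep) : (ρ₂.quotientInvariants N).toTopRep ⟶ (imRep N g).toTopRep :=
  TopRep.ofHom
    { toLinearMap := LinearMap.rangeRestrict (ContinuousRep.invariantsHom (N := N) g).hom.toLinearMap
      cont := continuous_of_discreteTopology
      isIntertwining' := by
        rintro ⟨a⟩
        ext w
        exact ContinuousRep.hom_comm_apply g a w.1 }

omit [CompactSpace G] [T2Space G] [TotallyDisconnectedSpace G] hN in
/-- **`0 → M₁^N → M₂^N → X → 0` is short exact.** [cite: Shatz1972, Ch. II §1 Prop. 3] -/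
theorem isSES_toIm (h : IsSES f g) : IsSES (ContinuousRep.invariantsHom (N := N) f) (toIm N g) := by
  refine ⟨?_, ?_, ?_, ?_⟩
  · ext ⟨m, hm⟩
    exact congr(($(h.comp_eq_zero)).hom m)
  · exact fun a b hab => Subtype.ext (h.injective (congrArg Subtype.val hab))
  · rintro ⟨y, hy⟩ hzero
    have hzero' : g.hom y = 0 := congrArg (fun v : imSub N g => ((v : ρ₃.invariantsOf N) : M₃)) hzero
    obtain ⟨m, hm⟩ := h.exact_mid y hzero'
    refine ⟨⟨m, fun n => h.injective ?_⟩, Subtype.ext hm⟩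
    refine (TopRep.hom_comm_apply f (n : G) m).trans ?_
    rw [hm]
    exact hy n
  · rintro ⟨v, w, rfl⟩
    exact ⟨w, rfl⟩

omit [T2Space G] in
/-- **`0 → X → M₃^N →δ H¹(N, M₁) → 0` is short exact** when `H¹(N, M₂) = 0` (`X = ker δ_N` by
exactness at `M₃^N`). [cite: Shatz1972, Ch. II §1 Prop. 3] -/
theorem isSES_deltaNHom (h : IsSES f g)
    [Subsingleton (continuousCohomology 1 ((ρ₂.restrict (subgroupIncl N)).toTopRep))] :
    IsSES (imIncl N g) (deltaNHom N h) := by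
  have hNs := h.restrictN (N := N)
  refine ⟨?_, fun a b hab => Subtype.ext hab, fun v hv => ?_, fun y => ?_⟩
  · ext ⟨v, w, hw⟩
    change deltaN N h v = 0
    rw [deltaN_apply, map_eq_zero_iff _ (HOne.of N ρ₁).injective, IsSES.δ₀_eq_zero_iff]
    exact ⟨w.1, fun n => w.2 n, congrArg Subtype.val hw⟩
  · change deltaN N h v = 0 at hv
    rw [deltaN_apply, map_eq_zero_iff _ (HOne.of N ρ₁).injective, IsSES.δ₀_eq_zero_iff] at hv
    obtain ⟨w, hw, hwv⟩ := hv
    exact ⟨⟨v, ⟨w, fun n => hw n⟩, Subtype.ext hwv⟩, rfl⟩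
  · obtain ⟨v, hv⟩ := hNs.exists_δ₀_eq_of_map_one_eq_zero ((HOne.of N ρ₁).symm y) (Subsingleton.elim _ _)
    refine ⟨⟨v.1, v.2⟩, ?_⟩
    change deltaN N h _ = y
    rw [deltaN_apply]
    exact (congrArg _ hv).trans ((HOne.of N ρ₁).apply_symm_apply y)

omit [N.Normal] [CompactSpace G] [T2Space G] [TotallyDisconnectedSpace G] hN in
/-- **`res ∘ δ₀ = δ₀_N`**: the connecting map commutes with restriction to `N` on invariants.
[folklore] -/
theorem resSubgroup_δ₀ (h : IsSES f g) (v : M₃) (hv : v ∈ ρ₃.toTopRep.ρ.invariants)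
    (hv' : v ∈ (ρ₃.restrict (subgroupIncl N)).toTopRep.ρ.invariants) :
    resSubgroup ρ₁.toTopRep N 1 (h.δ₀ ⟨v, hv⟩) = (h.restrictN (N := N)).δ₀ ⟨v, hv'⟩ := by
  have hNs := h.restrictN (N := N)
  have hw : g.hom (h.lift v) = v := h.g_lift v
  have hwG : g.hom (h.lift v) ∈ ρ₃.toTopRep.ρ.invariants := by rw [hw]; exact hv
  have hwN : (restrictHom N g).hom (h.lift v) ∈ (ρ₃.restrict (subgroupIncl N)).toTopRep.ρ.invariants := by
    rw [restrictHom_hom_apply, hw]; exact hv'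
  have A : h.δ₀ ⟨v, hv⟩ = oneCocycleClass _ (h.δ₀Cocycle (h.lift v) hwG) := h.δ₀_apply_eq _ _ hw
  have B : hNs.δ₀ ⟨v, hv'⟩ = oneCocycleClass _ (hNs.δ₀Cocycle (h.lift v) hwN) := hNs.δ₀_apply_eq _ _ hw
  rw [A, B, resSubgroup_oneCocycleClass]
  refine congrArg _ (Subtype.ext (ContinuousMap.ext fun n => hNs.injective ?_))
  rw [hNs.f_δ₀Cocycle_apply, contOneCocycles.pullback_apply]
  change (restrictHom N f).hom ((h.δ₀Cocycle (h.lift v) hwG).1 (n : G)) = _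
  rw [restrictHom_hom_apply, h.f_δ₀Cocycle_apply]
  rfl

end Shift

/-! ### The counts -/

section Count

variable {M₁ : Type u} [AddCommGroup M₁] [TopologicalSpace M₁] [DiscreteTopology M₁]
variable {M₂ : Type u} [AddCommGroup M₂] [TopologicalSpace M₂] [DiscreteTopology M₂]
variable {M₃ : Type u} [AddCommGroup M₃] [TopologicalSpace M₃] [DiscreteTopology M₃]
variable {ρ₁ : ContinuousRep G ℤ M₁} {ρ₂ : ContinuousRep G ℤ M₂} {ρ₃ : ContinuousRep G ℤ M₃}
variable {f : ρ₁.toTopRep ⟶ ρ₂.toTopRep} {g : ρ₂.toTopRep ⟶ ρ₃.toTopRep}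

omit [T2Space G] [TotallyDisconnectedSpace G] hN in
/-- `H¹(G/N, X) = 0` when `H¹(G/N, M₂^N) = 0 = H²(G/N, M₁^N)`. [folklore] -/
theorem subsingleton_one_imRep (h : IsSES f g)
    [Subsingleton (continuousCohomology 1 (ρ₂.quotientInvariants N).toTopRep)]
    [Subsingleton (continuousCohomology 2 (ρ₁.quotientInvariants N).toTopRep)] :
    Subsingleton (continuousCohomology 1 (imRep N g).toTopRep) :=
  (isSES_toIm N h).subsingleton_X₃ 0 ‹_› ‹_›

omit [T2Space G] [TotallyDisconnectedSpace G] hN in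
/-- `H²(G/N, X) = 0` when `H²(G/N, M₂^N) = 0 = H³(G/N, M₁^N)`. [folklore] -/
theorem subsingleton_two_imRep (h : IsSES f g)
    [Subsingleton (continuousCohomology 2 (ρ₂.quotientInvariants N).toTopRep)]
    [Subsingleton (continuousCohomology 3 (ρ₁.quotientInvariants N).toTopRep)] :
    Subsingleton (continuousCohomology 2 (imRep N g).toTopRep) :=
  (isSES_toIm N h).subsingleton_X₃ 1 ‹_› ‹_›

/-- **(HS2), generic form.** For a short exact sequence `0 → M₁ → M₂ → M₃ → 0` of discrete
`G`-modules with `M₂` acyclic for `G` and `N` in degrees `1, 2`, `M₂^N` acyclic for `G/N` in degrees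
`1, 2`, and `H²(N, M₁) = H²(G/N, M₁^N) = H³(G/N, M₁^N) = 0`:
`#H²(G, M₁) = #H¹(G/N, H¹(N, M₁))` (`H²(G, M₁) ≅ H¹(G, M₃) ≅ H¹(G/N, M₃^N) ≅ H¹(G/N, H¹(N, M₁))`).
[cite: SerreGaloisCohomology1997, I §2.6 (b)] [cite: MilneADT2006, I §2 Lemma 2.9 (proof)] -/
theorem IsSES.natCard_two_eq_natCard_one_hOneRep (h : IsSES f g)
    [Subsingleton (continuousCohomology 1 ρ₂.toTopRep)] [Subsingleton (continuousCohomology 2 ρ₂.toTopRep)]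
    [Subsingleton (continuousCohomology 1 ((ρ₂.restrict (subgroupIncl N)).toTopRep))]
    [Subsingleton (continuousCohomology 2 ((ρ₁.restrict (subgroupIncl N)).toTopRep))]
    [Subsingleton (continuousCohomology 1 (ρ₂.quotientInvariants N).toTopRep)]
    [Subsingleton (continuousCohomology 2 (ρ₂.quotientInvariants N).toTopRep)]
    [Subsingleton (continuousCohomology 2 (ρ₁.quotientInvariants N).toTopRep)]
    [Subsingleton (continuousCohomology 3 (ρ₁.quotientInvariants N).toTopRep)] :
    Nat.card (continuousCohomology 2 ρ₁.toTopRep) = Nat.card (continuousCohomology 1 (hOneRep N ρ₁).toTopRep) := by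
  -- (a) `H²(G, M₁) ≅ H¹(G, M₃)`
  have e1 : Nat.card (continuousCohomology 1 ρ₃.toTopRep) = Nat.card (continuousCohomology 2 ρ₁.toTopRep) :=
    Nat.card_eq_of_bijective h.δ₁ ⟨δ₁_injective_of_subsingleton h, δ₁_surjective_of_subsingleton h⟩
  -- (b) inflation `H¹(G/N, M₃^N) → H¹(G, M₃)` is bijective since `H¹(N, M₃) = 0`
  haveI : Subsingleton (continuousCohomology 1 ((ρ₃.restrict (subgroupIncl N)).toTopRep)) :=
    (h.restrictN (N := N)).subsingleton_X₃ 0 ‹_› ‹_›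
  have e2 : Nat.card (continuousCohomology 1 (ρ₃.quotientInvariants N).toTopRep) =
      Nat.card (continuousCohomology 1 ρ₃.toTopRep) := by
    refine Nat.card_eq_of_bijective (infOne N ρ₃) ⟨infOne_injective N ρ₃, fun y => ?_⟩
    have h0 : resSubgroup ρ₃.toTopRep N 1 y = 0 :=
      @Subsingleton.elim (continuousCohomology 1 ((ρ₃.restrict (subgroupIncl N)).toTopRep)) _ _ _
    obtain ⟨x, hx⟩ := ((infOne_exact_resSubgroup N ρ₃) y).1 h0
    exact ⟨x, hx⟩
  -- (c) `H¹(G/N, M₃^N) ≅ H¹(G/N, H¹(N, M₁))`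
  haveI := subsingleton_one_imRep N h
  haveI := subsingleton_two_imRep N h
  have hXQT := isSES_deltaNHom N h
  have e3 : Nat.card (continuousCohomology 1 (ρ₃.quotientInvariants N).toTopRep) =
      Nat.card (continuousCohomology 1 (hOneRep N ρ₁).toTopRep) := by
    refine Nat.card_eq_of_bijective (cohomologyMap (deltaNHom N h) 1) ⟨fun a b hab => ?_, fun z => ?_⟩
    · rw [← sub_eq_zero] at hab ⊢
      rw [← map_sub] at hab
      obtain ⟨x, hx⟩ := hXQT.exists_map_one_eq_of_map_one_eq_zero _ hab
      rw [← hx, Subsingleton.elim x 0, map_zero]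
    · exact hXQT.exists_map_one_eq_of_δ₁_eq_zero z (Subsingleton.elim _ _)
  rw [← e1, ← e2, e3]

omit [T2Space G] in
/-- **(HS1), generic form**: with `M₂` as above and `H²(G/N, M₁^N) = 0`,
`#H¹(G, M₁) = #H¹(G/N, M₁^N) · #H¹(N, M₁)^{G/N}` — exactness of the inflation–restriction sequence
`0 → H¹(G/N, M₁^N) → H¹(G, M₁) → H¹(N, M₁)^{G/N} → H²(G/N, M₁^N)`, the surjectivity onto the
invariant classes coming from `(M₃^N)^{G/N} ↠ (H¹(N, M₁))^{G/N}` (`H¹(G/N, X) = 0`) and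
`res ∘ δ₀ = δ₀_N`. [cite: SerreGaloisCohomology1997, I §2.6 (b)] [cite: NeukirchSchmidtWingberg2008, (1.6.7)] -/
theorem IsSES.natCard_one_eq_mul (h : IsSES f g) [Finite (continuousCohomology 1 ρ₁.toTopRep)]
    [Subsingleton (continuousCohomology 1 ((ρ₂.restrict (subgroupIncl N)).toTopRep))]
    [Subsingleton (continuousCohomology 1 (ρ₂.quotientInvariants N).toTopRep)]
    [Subsingleton (continuousCohomology 2 (ρ₁.quotientInvariants N).toTopRep)] :
    Nat.card (continuousCohomology 1 ρ₁.toTopRep) =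
      Nat.card (continuousCohomology 1 (ρ₁.quotientInvariants N).toTopRep) *
        Nat.card (hOneRep N ρ₁).toTopRep.ρ.invariants := by
  classical
  let inf : continuousCohomology 1 (ρ₁.quotientInvariants N).toTopRep →+ continuousCohomology 1 ρ₁.toTopRep :=
    (infOne N ρ₁).hom.toLinearMap.toAddMonoidHom
  let res : continuousCohomology 1 ρ₁.toTopRep →+ continuousCohomology 1 (subgroupRep ρ₁.toTopRep N) :=
    (resSubgroup ρ₁.toTopRep N 1).hom.toLinearMap.toAddMonoidHom
  have hex := infOne_exact_resSubgroup N ρ₁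
  have e1 : Nat.card (continuousCohomology 1 ρ₁.toTopRep) = Nat.card inf.range * Nat.card res.range :=
    card_eq_card_range_mul_of_exact inf res (fun a => (hex _).2 ⟨a, rfl⟩) fun b hb => (hex b).1 hb
  rw [card_range_of_injective' inf (infOne_injective N ρ₁)] at e1
  rw [e1]
  congr 1
  -- `range res = H¹(N, M₁)^{G/N}`
  haveI := subsingleton_one_imRep N h
  have hXQT := isSES_deltaNHom N h
  refine Nat.card_congr (Equiv.subtypeEquiv (HOne.of N ρ₁).toEquiv fun y => ?_)
  change y ∈ res.range ↔ HOne.of N ρ₁ y ∈ (hOneRep N ρ₁).toTopRep.ρ.invariants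
  rw [mem_invariants_hOneRep_iff]
  constructor
  · rintro ⟨x, rfl⟩ a
    exact conjMap_resSubgroup_one ρ₁.toTopRep N a x
  · intro hy
    -- `y = δ_N q` with `q ∈ (M₃^N)^{G/N}` since `H¹(G/N, X) = 0`
    have hy' : HOne.of N ρ₁ y ∈ (hOneRep N ρ₁).toTopRep.ρ.invariants := (mem_invariants_hOneRep_iff N ρ₁ _).2 hy
    obtain ⟨q, hq, hqy⟩ := (hXQT.δ₀_eq_zero_iff ⟨HOne.of N ρ₁ y, hy'⟩).1 (Subsingleton.elim _ _)
    have hqG : q.1 ∈ ρ₃.toTopRep.ρ.invariants := fun a => by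
      have := congrArg Subtype.val (hq (QuotientGroup.mk a))
      exact this
    refine ⟨h.δ₀ ⟨q.1, hqG⟩, ?_⟩
    change resSubgroup ρ₁.toTopRep N 1 (h.δ₀ ⟨q.1, hqG⟩) = y
    rw [resSubgroup_δ₀ N h q.1 hqG q.2]
    exact ((HOne.of N ρ₁).symm_apply_apply _).symm.trans (congrArg (HOne.of N ρ₁).symm hqy)

end Count

/-! ### The coinduced dimension shift -/

section Coind

/-- **(HS2)**: for a discrete `G`-module `M` with `H²(N, M) = 0` and
`H²(G/N, M^N) = H³(G/N, M^N) = 0`, `#H²(G, M) = #H¹(G/N, H¹(N, M))` (Hochschild–Serre in the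
degenerate case `cd(N), cd(G/N) ≤ 1`; Harari, proof of Prop. 10.12: `H²(K, A) = H¹(Ẑ, H¹(I_K, A))`).
[cite: SerreGaloisCohomology1997, I §2.6 (b)] [cite: MilneADT2006, I §2 Lemma 2.9 (proof)] -/
theorem natCard_two_eq_natCard_one_hOneRep
    [Subsingleton (continuousCohomology 2 ((ρ.restrict (subgroupIncl N)).toTopRep))]
    [Subsingleton (continuousCohomology 2 (ρ.quotientInvariants N).toTopRep)]
    [Subsingleton (continuousCohomology 3 (ρ.quotientInvariants N).toTopRep)] :
    Nat.card (continuousCohomology 2 ρ.toTopRep) = Nat.card (continuousCohomology 1 (hOneRep N ρ).toTopRep) := by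
  haveI := subsingleton_coind ρ 0
  haveI := subsingleton_coind ρ 1
  haveI := subsingleton_coind_restrict N ρ 0
  haveI := subsingleton_coind_invariants N ρ 0
  haveI := subsingleton_coind_invariants N ρ 1
  exact (isSES_coind ρ).natCard_two_eq_natCard_one_hOneRep N

/-- **(HS1)**: for a discrete `G`-module `M` with `H¹(G, M)` finite and `H²(G/N, M^N) = 0`,
`#H¹(G, M) = #H¹(G/N, M^N) · #H¹(N, M)^{G/N}` (the five-term inflation–restriction sequence;
Harari, proof of Prop. 10.12: `0 → H¹(Ẑ, A^I) → H¹(K, A) → H⁰(Ẑ, H¹(I, A)) → 0`).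
[cite: SerreGaloisCohomology1997, I §2.6 (b)] [cite: NeukirchSchmidtWingberg2008, (1.6.7)] -/
theorem natCard_one_eq_mul [Finite (continuousCohomology 1 ρ.toTopRep)]
    [Subsingleton (continuousCohomology 2 (ρ.quotientInvariants N).toTopRep)] :
    Nat.card (continuousCohomology 1 ρ.toTopRep) =
      Nat.card (continuousCohomology 1 (ρ.quotientInvariants N).toTopRep) *
        Nat.card (hOneRep N ρ).toTopRep.ρ.invariants := by
  haveI := subsingleton_coind_restrict N ρ 0
  haveI := subsingleton_coind_invariants N ρ 0
  exact (isSES_coind ρ).natCard_one_eq_mul N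

/-- The invariants of `M^N` under `G/N` are the invariants of `G` (as a bijection). [folklore] -/
def invariantsQuotientInvariantsEquiv : (ρ.quotientInvariants N).toTopRep.ρ.invariants ≃ ρ.toTopRep.ρ.invariants where
  toFun v := ⟨v.1.1, fun a => congrArg Subtype.val (v.2 (QuotientGroup.mk a))⟩
  invFun w := ⟨⟨w.1, fun n => w.2 (n : G)⟩, fun q => by
    induction q using QuotientGroup.induction_on with
    | H a => exact Subtype.ext (w.2 a)⟩
  left_inv _ := rfl
  right_inv _ := rfl

end Coind

end Literature.NumberTheory.GaloisRepresentations

end
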